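import Summits.Langlands.Langlands.Theorems.QuadraticWindowHostInducedRepOfPrintedInputs
import Summits.Langlands.Langlands.Theorems.QuadraticWindowHostInducedRepPackageComposeCM
import HarnessLib

/-!
# `QuadraticWindow.HostInducedRep` from TEN named facts and the printed-input glue from EIGHT
# (the Hecke-character extension fact discharged in the case the line uses)

Item stmt-Langlands-16559 (`HostInducedRepOfPrintedInputs`, route `QuadraticWindow`) and crux
stmt-Langlands-10902 (`HostInducedRep`).  The landed closures `HostInducedRep_proof_eleven`
(Theorems/QuadraticWindowHostInducedRep.lean) and `HostInducedRepOfPrintedInputs_proof`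
(Theorems/QuadraticWindowHostInducedRepOfPrintedInputs.lean) take, among their named facts, the inline
`hExt` = `HewittRoss_heckeCharacter_extension_quadratic` (extension of unitary idele class characters
along a quadratic `K/F₀` with prescribed unramifiedness; Pontryagin–Hewitt–Ross (24.12)).  The line uses it
only for `F₀` totally real, `K` CM and `χ₀` of finite order, and that case is now a THEOREM of the tree
(`HeckeCharacter.exists_extension_quadratic_of_isTotallyComplex_of_isFiniteOrder`,
Literature/NumberTheory/GaloisRepresentations/HeckeCharacterExtensionQuadraticCMProofs.lean; Weil's
open-subgroup/Baer method plus a root-of-unity adjustment, no duality).  Hence: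

* `HostInducedRep_proof_ten` — the crux from TEN named facts (the eleven minus `hExt`), verbatim
  `HostInducedRep_proof_eleven` through `stub_package_cm`;
* `HostInducedRepOfPrintedInputs_proof_eight` — the glue from EIGHT named facts: lang.S27,
  Fakhruddin–Pilloni 9.10 (Cont), Jacquet–Shalika SMO, Arthur–Clozel placewise cuspidal base change,
  Arthur–Clozel archimedean lifting, Henniart's infinity type, Mok's parity pin, Mok's dichotomy.
Both remain CONDITIONAL (trust base = those names); the item does not close.
-/

set_option linter.dupNamespace false -- `Summit.Langlands.Langlands.…` repeats `Langlands` by design (D-0017)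

noncomputable section

open Polynomial
open scoped NumberField Classical
open IsDedekindDomain Field NumberField Filter
open Literature.NumberTheory.GaloisRepresentations Literature.NumberTheory.Automorphic
open Summit.Langlands.Langlands.Theses.QuadraticWindow
open Summit.Langlands.Langlands.Theorems.HostInducedRep.OneTransparentPane
open Summit.Langlands.Langlands.Theorems.HostInducedRep.Slices
open Literature.NumberTheory.GaloisRepresentations.QuadraticFamily
open Summit.Langlands.Langlands.Theorems.HostInducedRep.GrsExplicitDescent

namespace Summit.Langlands.Langlands.Theorems

/-- **`HostInducedRep_proof_ten` — the crux `QuadraticWindow.HostInducedRep` from TEN published named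
facts**: lang.S27 `exists_galoisRep_of_regularAlgebraic`; `FakhruddinPilloni2021_galoisRep_of_weaklyRegular_oddCont`;
`JacquetShalika1981_isEssConjSelfDual_of_isConjSelfDualAE`; `automorphicInduction_cyclic_cuspidal_unramified`;
`ArthurClozel1989_cuspidalBaseChange_unramified`; `ArthurClozel1989_strongLifting_archimedean`;
`Henniart2012_infinityType_of_automorphicInduction`; `Mok2014_archimedean_parity_of_asaiSignCont`;
`Mok2014_partialAsaiL_continuation_pole_dichotomy`; `GrbacShahidi2015_partialAsaiL_at_one` — the Hecke-character
extension input of `HostInducedRep_proof_eleven` being discharged (`stub_package_cm`).  Dependency matrix as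
before: ranks `n ≤ 1` no fact; `F` totally real or CM: `hS27` only; mixed `F`, `n ≥ 2`: the ten.
CONDITIONAL: the trust base is the ten names. [cite: FakhruddinPilloni2021, Thm. 9.10]
[cite: Mok2014, Thm. 2.5.4 (a) and Cor. 2.5.5] [cite: ArthurClozelAMS120, Ch. 3 Thm. 4.2, 5.1, 6.2]
[cite: HarrisLanTaylorThorneRMS2016, Thm. A] -/
theorem HostInducedRep_proof_ten
    (hS27 : exists_galoisRep_of_regularAlgebraic)
    (hFP : FakhruddinPilloni2021_galoisRep_of_weaklyRegular_oddCont)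
    (hSMO : JacquetShalika1981_isEssConjSelfDual_of_isConjSelfDualAE)
    (hAI : automorphicInduction_cyclic_cuspidal_unramified)
    (hBC : ArthurClozel1989_cuspidalBaseChange_unramified)
    (hArchBC : ArthurClozel1989_strongLifting_archimedean)
    (hHen : Henniart2012_infinityType_of_automorphicInduction)
    (hPin : Mok2014_archimedean_parity_of_asaiSignCont)
    (hMok : Mok2014_partialAsaiL_continuation_pole_dichotomy)
    (hGS : GrbacShahidi2015_partialAsaiL_at_one) :
    Summit.Langlands.Langlands.Theses.QuadraticWindow.HostInducedRep := by
  refine hostInducedRep_of_forall_two_le fun n _hn ↦ ?_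
  intro F₀ F _ _ _ _ _ τ hTR hdeg hτ hcpt π e k hreg hpol hpar hodd ℓ _ ι hℓ hunr eψ hψunr hψpar hψnti
  by_cases hF : IsTotallyReal F ∨ IsCMField F
  · exact inducedPackage_of_S27 hS27 F₀ F n hcpt π ℓ ι eψ hF hdeg hreg
  have hF' : ¬ IsTotallyReal F := fun h ↦ hF (Or.inl h)
  have hH : Hyps τ n π e k ℓ eψ :=
    ⟨hTR, hdeg, hτ, hreg, hpol, hpar, hodd, hℓ, hunr, hψunr, hψpar, hψnti⟩
  have asaiSignExistsCont : ∀ (F E : Type) [Field F] [NumberField F] [Field E] [NumberField E]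
      [Algebra F E] (c : E ≃ₐ[F] E), Module.finrank F E = 2 → c ≠ 1 →
      ∀ (N : ℕ) (hcpt : isCompact_glFiniteIntegralLevel N E) (P : CuspidalAutomorphicRepData N E hcpt),
        0 < N → P.1.IsConjSelfDualAE c → ∃ κ : ℤˣ, P.1.HasAsaiSignCont c κ :=
    fun _ _ _ _ _ _ _ _ h2 hc _ _ P hN hP ↦ P.exists_hasAsaiSignCont hMok h2 hc hN hP
  have hpane := stub_paneLaw_cont asaiSignExistsCont hPin (asaiPoleTransfer_cont hMok hGS)
  obtain ⟨m, B, hm, hB, hK, τ', T, ψ₁, hsix, hdict, hcov⟩ :=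
    stub_package_cm hAI hBC hArchBC hHen exists_hasInfinityType_gl_one asaiSignExistsCont hPin
      hpane F₀ F τ n hcpt π e k ℓ ι eψ hH hF'
  -- the ℓ-adic representation of each member (FP 9.10 + JS SMO)
  have hr : ∀ D : GoodPrime F₀ m B, ∃ r : FramedGaloisRep (sqrtNegField F₀ D.1) (PadicAlgCl ℓ) (2 * n),
      r.toGaloisRep.IsSemisimple ∧
        ∀ (u : HeightOneSpectrum (𝓞 (sqrtNegField F₀ D.1))) (β : Multiset ℂ),
          ((ℓ : ℕ) : 𝓞 (sqrtNegField F₀ D.1)) ∉ u.asIdeal → (τ' D).1.HasSatakeParamAt u β →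
          (ψ₁ D).IsUnramifiedAt u →
            r.IsUnramifiedAt u ∧ r.HasFrobCharpolyAt u (arithFrobPolyOfSatake ι u.residueCard (2 * n)
              (β.map (fun b ↦ b * ((ψ₁ D).valueAtUniformizer u)⁻¹))) := by
    intro D
    haveI : IsCMField (sqrtNegField F₀ D.1) := GoodPrime.isCMField (Or.inl hTR) D
    obtain ⟨h1, h2, h3, h4, h5, h6⟩ := hsix D
    exact stub_galoisOverK_cont hFP hSMO (2 * n) (sqrtNegField F₀ D.1) (hK D) (τ' D) (T D) (ψ₁ D)
      h1 h2 h3 h4 h5 h6 ℓ ι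
  choose r hrss hrloc using hr
  refine stub_patch F₀ F n hcpt π ℓ ι eψ m B hm hB r hrss (fun D ↦ ?_) ?_
  · filter_upwards [hdict D] with u hu v α c huv hv hg
    obtain ⟨hℓu, hψu, β, hβ, heq⟩ := hu v α c huv hv hg
    obtain ⟨hunr', hchar⟩ := hrloc D u β hℓu hβ hψu
    exact ⟨hunr', heq ▸ hchar⟩
  · intro v α c hv hg
    obtain ⟨D, hsplit, u, huv, hℓu, hψu, β, hβ, heq⟩ := hcov v α c hv hg
    obtain ⟨hunr', hchar⟩ := hrloc D u β hℓu hβ hψu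
    exact ⟨D, hsplit, u, huv, hunr', heq ▸ hchar⟩

/-- **`HostInducedRepOfPrintedInputs_proof_eight` — the support glue of route `QuadraticWindow`
(stmt-Langlands-16559), CONDITIONAL on EIGHT published named facts** (lang.S27, Fakhruddin–Pilloni 9.10
Cont, Jacquet–Shalika SMO, Arthur–Clozel placewise cuspidal base change, Arthur–Clozel archimedean strong
lifting, Henniart's infinity type of automorphic induction, Mok's archimedean parity pin, Mok's Asai-pole
dichotomy): the printed inputs `AI`, `GS` are fed to `HostInducedRep_proof_ten` (`GK` unused).  This does
NOT settle the item: the trust base is exactly the eight names. [cite: FakhruddinPilloni2021, Thm. 9.10]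
[cite: Mok2014, Thm. 2.5.4 (a) and Cor. 2.5.5] [cite: ArthurClozelAMS120, Ch. 3 Thm. 4.2, 5.1, 6.2]
[cite: HarrisLanTaylorThorneRMS2016, Thm. A] -/
theorem HostInducedRepOfPrintedInputs_proof_eight
    (hS27 : exists_galoisRep_of_regularAlgebraic)
    (hFP : FakhruddinPilloni2021_galoisRep_of_weaklyRegular_oddCont)
    (hSMO : JacquetShalika1981_isEssConjSelfDual_of_isConjSelfDualAE)
    (hBC : ArthurClozel1989_cuspidalBaseChange_unramified)
    (hArchBC : ArthurClozel1989_strongLifting_archimedean)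
    (hHen : Henniart2012_infinityType_of_automorphicInduction)
    (hPin : Mok2014_archimedean_parity_of_asaiSignCont)
    (hMok : Mok2014_partialAsaiL_continuation_pole_dichotomy) :
    Summit.Langlands.Langlands.Theses.QuadraticWindow.HostInducedRepOfPrintedInputs :=
  fun _hGK hAI hGS ↦
    HostInducedRep_proof_ten hS27 hFP hSMO (automorphicInductionUnramified_iff.mp hAI) hBC hArchBC hHen hPin
      hMok (partialAsaiLAtOne_iff.mp hGS)

end Summit.Langlands.Langlands.Theorems

end
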